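import Literature.Barriers.AnomalousDissipation.RenormalisationNoAnomalyFullWindow
import Literature.Analysis.FluidPDE.TurbPassiveScalarProofs
import Literature.Analysis.FluidPDE.FractalHomogenizationLackOfSelectionProofs
import Literature.Analysis.FluidPDE.PassiveScalarRenormalisation
import Literature.Analysis.FunctionSpaces.TorusHolderBridge
import HarnessLib

/-!
# Barrier (AnomalousDissipation), addendum: the vendored fact `BagnaraEtAl2026_thm31` is FALSE —
# kernel refutation, through the DiPerna–Lions renormalisation theorem for smooth drifts
(D-0021 barrier catalogue for `Summits/AnomalousDissipation`; companion of
`Barriers/AnomalousDissipation/RenormalisationNoAnomaly{,FullWindow}`; everything PROVED, no named fact,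
no new definition)

Finding L30-1 (ad-ideate literature seat, 2026-08-29; see the module docstring of
`RenormalisationNoAnomalyFullWindow` and the ERRATUM on
`Literature.Analysis.FluidPDE.BagnaraEtAl2026_thm31`): the named fact `BagnaraEtAl2026_thm31`
(Bagnara–Boutros–De Lellis–Mayboroda, arXiv:2603.11466v3, Thm. 3.1, typed over the tree's HALF-OPEN weak
class) concludes on the full window `(0,T)` from a hypothesis blind to the endpoint `T`.  This file reduces
its NEGATION to the classical DiPerna–Lions renormalisation theorem for smooth divergence-free drifts on a
closed slab `[0,τ] × T^d` [cite: DiPernaLions1989, §II.3 Thm. II.3, Cor. II.1] — spelled INLINE as the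
hypothesis `H` of the reduction theorem (§2) and PROVED in §3 from the tree's DiPerna–Lions theorem
`Torus.IsWeakScalarTransportOn.comp_of_lipschitz_of_abs_le` (`Analysis/FluidPDE/PassiveScalarRenormalisation`),
so that the refutation `not_BagnaraEtAl2026_thm31` is unconditional:

* `hasRenormalisationProperty_of_forall_lt` — **patching of horizons**: along a bounded drift, the
  renormalisation property on every sub-horizon `τ < T` gives it on `[0,T)` (each test of horizon `T`
  has some horizon `τ < T`; the class fields on `(0,T)` of `β ∘ θ` come from those of `θ` and the
  boundedness of `β` on `[-M, M]`).
* `not_BagnaraEtAl2026_thm31_of_smoothDriftsRenormalise` — **`H → ¬ BagnaraEtAl2026_thm31`**: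
  the Drivas–Elgindi–Iyer–Jeong field (ARMA 243 (2022), Thm. 2 — the tree's theorem
  `Torus.DEIJ.deij_theorem2`: smooth and divergence free on `[0,T) × T²`, bounded, and for the datum
  `θ₀ = cos(2π x₁)` and EVERY `κ > 0`, EVERY weak solution has `κ∫₀ᵀ‖∇θ^κ‖² ≥ c‖θ₀‖² > 0`) is bounded on
  the slab, weakly divergence free at every time, and — by the hypothesis on each `[0,τ]`, `τ < T`, and
  the patching — has `Torus.HasRenormalizationPropertyOn T`; bounded weak solutions `θ_ε` of the
  `ε`-problems exist for every `ε > 0` (`exists_isWeakScalarTransportOn_of_abs_le`); the fact would send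
  their dissipation on `(0,T)` to `0` as `ε → 0⁺`, contradicting the DEIJ floor.

* `hasRenormalisationProperty_of_lipschitz` / `hasRenormalisationProperty_of_isSmoothSpaceTimeOn` /
  `Torus.hasRenormalizationPropertyOn_of_isSmoothSpaceTimeOn` — **membership in the technique class**
  (DiPerna–Lions 1989, Thm. II.3 / Cor. II.1 for `W^{1,∞}` drifts): a drift with `L(t)`-Lipschitz slices,
  `∫₀ᵀ L < ∞`, has the renormalisation property on `[0,T)`; in particular every field jointly smooth on a
  closed slab `[0,τ] × T^d` (bounded spatial derivatives give a uniform Lipschitz constant).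
* `Torus.not_allowsDissipationAnomalyOn_of_isSmoothSpaceTimeOn` — **no dissipation anomaly strictly inside
  the smoothness slab**: a field smooth and divergence free on `[0,T'] × T^d` allows no anomaly on `[0,T]`,
  `T < T'` (the corrected BBDM Thm. 3.1 + DiPerna–Lions).
* `not_BagnaraEtAl2026_thm31` — **`¬ BagnaraEtAl2026_thm31`, unconditionally.**

NOT: nothing about the Navier–Stokes summit; the corrected (full-window / longer-horizon) form of BBDM
Thm. 3.1 is `BagnaraBoutrosDeLellisMayboroda2026_thm31_fullWindow` in the companion file.

## References
* M. Bagnara, D. W. Boutros, C. De Lellis, S. Mayboroda, arXiv:2603.11466v3 (2026), Def. 2.1 p. 5,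
  Thm. 3.1 p. 11. [`BagnaraEtAl2026`]
* T. D. Drivas, T. M. Elgindi, G. Iyer, I.-J. Jeong, Arch. Ration. Mech. Anal. 243 (2022), Thms. 1–2
  (arXiv:1911.03271, p. 3). [`DrivasEtAl2022`]
* R. J. DiPerna, P.-L. Lions, Invent. Math. 98 (1989), §II.3, Thm. II.3 and Cor. II.1. [`DiPernaLions1989`]
-/

open MeasureTheory Set Filter Topology Function
open scoped ENNReal NNReal InnerProductSpace

noncomputable section

namespace Literature.Barriers.AnomalousDissipation

open Literature.Analysis.FluidPDE Literature.Analysis.FluidPDE.Torus Literature.Analysis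
open Literature.Analysis.FunctionSpaces (ContinuousInHolderOn MemLpHolder)

variable {d : Type*} [Fintype d]

/-! ## §1 Patching of horizons -/

/-- **Renormalisation on every sub-horizon ⇒ renormalisation on the half-open window.**  For a drift
bounded on `(0,T) × T^d`: if `u` has the renormalisation property on `[0,τ)` for every `0 < τ < T`, it has
it on `[0,T)` (the tree's test fields of horizon `T` vanish after some `T' < T`, so each is a test of some
horizon `τ ∈ (T', T)`; the class bookkeeping on `(0,T)` for `β ∘ θ` uses `|θ| ≤ M` and the boundedness of
the continuous `β` on `[-M, M]`). [cite: DiPernaLions1989, §II.3 Thm. II.3 (renormalised solutions; localisation in time)] -/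
theorem hasRenormalisationProperty_of_forall_lt {T : ℝ} (hT : 0 < T)
    {u : ℝ → UnitAddTorus d → EuclideanSpace ℝ d}
    (hu : MemLp (FunctionSpaces.Torus.stLift u) ∞ (volume.restrict (Ioo 0 T ×ˢ univ)))
    (h : ∀ τ, 0 < τ → τ < T → HasRenormalisationProperty τ u) :
    HasRenormalisationProperty T u := by
  intro θ₀ θ hθ₀ hbd hsol β hβ
  obtain ⟨M, hM⟩ := hbd
  -- `β` is bounded on `[-M, M]`, hence `β ∘ θ` is bounded a.e.
  obtain ⟨B₀, hB₀⟩ := (isCompact_Icc (a := -M) (b := M)).exists_bound_of_continuousOn hβ.continuous.continuousOn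
  set B : ℝ := max B₀ 0 with hBdef
  have hB : ∀ x ∈ Icc (-M) M, ‖β x‖ ≤ B := fun x hx => (hB₀ x hx).trans (le_max_left _ _)
  have hB0 : 0 ≤ B := le_max_right _ _
  have hβθ : ∀ᵐ t ∂(volume.restrict (Ioo 0 T)), ∀ᵐ x ∂(volume : Measure (UnitAddTorus d)),
      |β (θ t x)| ≤ B := by
    filter_upwards [hM] with t ht
    filter_upwards [ht] with x hx
    have hmem : θ t x ∈ Icc (-M) M := ⟨by linarith [neg_abs_le (θ t x), hx], (le_abs_self _).trans hx⟩
    simpa [Real.norm_eq_abs] using hB _ hmem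
  -- the drift is a.e. bounded on the slices
  obtain ⟨C, hC0, hC⟩ := ae_ae_norm_le_of_memLp_top_stLift hu
  -- sub-horizon renormalised solutions
  have hτsol : ∀ τ, 0 < τ → τ < T →
      IsWeakScalarTransportOn τ 0 u (fun x => β (θ₀ x)) (fun t x => β (θ t x)) := by
    intro τ hτ hτT
    exact (h τ hτ hτT) hθ₀ ⟨M, ae_restrict_of_ae_restrict_of_subset (Ioo_subset_Ioo_right hτT.le) hM⟩
      (hsol.of_le hτT.le) β hβ
  refine
    { aestronglyMeasurable := ?_
      aestronglyMeasurable_velocity := hsol.aestronglyMeasurable_velocity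
      ae_lintegral_sq_le := ?_
      lintegral_velocity_lt_top := hsol.lintegral_velocity_lt_top
      lintegral_mul_lt_top := ?_
      ae_isWeaklyDivFree := hsol.ae_isWeaklyDivFree
      weak_eq := ?_ }
  · -- measurability: `stLift (β ∘ θ) = β ∘ stLift θ`
    exact hβ.continuous.comp_aestronglyMeasurable hsol.aestronglyMeasurable
  · -- `L^∞ₜ L²ₓ`: `∫ |β(θ)|² ≤ B²`
    refine ⟨(B ^ 2).toNNReal, ?_⟩
    filter_upwards [hβθ] with t ht
    calc ∫⁻ x, ‖β (θ t x)‖ₑ ^ 2 ≤ ∫⁻ _ : UnitAddTorus d, ENNReal.ofReal B ^ 2 := by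
          refine lintegral_mono_ae (ht.mono fun x hx => ?_)
          gcongr
          rw [← ofReal_norm, Real.norm_eq_abs]
          exact ENNReal.ofReal_le_ofReal hx
      _ = ENNReal.ofReal B ^ 2 := by rw [lintegral_const, measure_univ, mul_one]
      _ = ((B ^ 2).toNNReal : ℝ≥0∞) := by rw [← ENNReal.ofReal_pow hB0]; rfl
  · -- `u · β(θ) ∈ L¹`: both factors are a.e. bounded on a slab of finite measure
    have hle : ∫⁻ t in Ioo 0 T, ∫⁻ x, ‖u t x‖ₑ * ‖β (θ t x)‖ₑ ≤
        ∫⁻ _ in Ioo 0 T, ENNReal.ofReal C * ENNReal.ofReal B := by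
      refine lintegral_mono_ae ?_
      filter_upwards [hC, hβθ] with t htC htB
      calc ∫⁻ x, ‖u t x‖ₑ * ‖β (θ t x)‖ₑ ≤ ∫⁻ _ : UnitAddTorus d, ENNReal.ofReal C * ENNReal.ofReal B := by
            refine lintegral_mono_ae ?_
            filter_upwards [htC, htB] with x hxC hxB
            gcongr
            · rw [← ofReal_norm]; exact ENNReal.ofReal_le_ofReal hxC
            · rw [← ofReal_norm, Real.norm_eq_abs]; exact ENNReal.ofReal_le_ofReal hxB
        _ = ENNReal.ofReal C * ENNReal.ofReal B := by rw [lintegral_const, measure_univ, mul_one]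
    refine hle.trans_lt ?_
    rw [lintegral_const, Measure.restrict_apply_univ]
    exact ENNReal.mul_lt_top (ENNReal.mul_lt_top ENNReal.ofReal_lt_top ENNReal.ofReal_lt_top) measure_Ioo_lt_top
  · -- the weak identity: every test of horizon `T` is a test of some horizon `τ < T`
    intro ψ hψ
    obtain ⟨T', hT'T, hψ0⟩ := hψ.2
    set τ : ℝ := (max T' 0 + T) / 2 with hτ
    have hτpos : 0 < τ := by rw [hτ]; have := le_max_right T' 0; linarith
    have hτT : τ < T := by rw [hτ]; have := max_lt hT'T hT; linarith
    have hT'τ : T' < τ := by rw [hτ]; have := le_max_left T' 0; linarith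
    have hψτ : FunctionSpaces.Torus.IsSpaceTimeTest τ ψ := ⟨hψ.1, T', hT'τ, hψ0⟩
    have key := (hτsol τ hτpos hτT).weak_eq ψ hψτ
    set I : ℝ → ℝ := fun t => ∫ x, β (θ t x) *
      (FunctionSpaces.Torus.timeDeriv ψ t x + ⟪u t x, FunctionSpaces.Torus.gradient (ψ t) x⟫_ℝ +
        (0 : ℝ) * FunctionSpaces.Torus.laplacian (ψ t) x) with hI
    have hI0 : ∀ t, T' < t → I t = 0 := by
      intro t ht
      simp only [hI]
      refine integral_eq_zero_of_ae (Eventually.of_forall fun x => ?_)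
      have h1 : FunctionSpaces.Torus.timeDeriv ψ t x = 0 := Torus.DEIJ.timeDeriv_eq_zero_of_forall_eq_zero hψ0 ht x
      have h2 : ψ t = 0 := hψ0 t ht.le
      have hl : FunctionSpaces.Torus.liftAt (0 : UnitAddTorus d → ℝ) x = fun _ => 0 := by
        funext v; simp [FunctionSpaces.Torus.liftAt_apply]
      have h3 : FunctionSpaces.Torus.gradient (0 : UnitAddTorus d → ℝ) x = 0 := by
        rw [FunctionSpaces.Torus.gradient, hl, gradient_fun_const]
      simp [h1, h2, h3]
    have hintτ : IntegrableOn I (Ioo 0 τ) volume := ((hτsol τ hτpos hτT).integrable_weakIntegrand hψτ).integral_prod_left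
    have hzero : IntegrableOn I (Ioo 0 T \ Ioo 0 τ) volume := by
      refine (integrableOn_zero : IntegrableOn (fun _ => (0:ℝ)) (Ioo 0 T \ Ioo 0 τ) volume).congr_fun ?_
        (measurableSet_Ioo.diff measurableSet_Ioo)
      intro t ht
      have h1 : t ∈ Ioo 0 T := ht.1
      have h2 : t ∉ Ioo 0 τ := ht.2
      have hτt : τ ≤ t := by
        by_contra hlt
        exact h2 ⟨h1.1, not_le.mp hlt⟩
      exact (hI0 t (hT'τ.trans_le hτt)).symm
    have hdiff : ∫ t in Ioo 0 T \ Ioo 0 τ, I t = 0 := by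
      refine setIntegral_eq_zero_of_forall_eq_zero fun t ht => hI0 t ?_
      have h1 : t ∈ Ioo 0 T := ht.1
      have h2 : t ∉ Ioo 0 τ := ht.2
      by_contra hle
      exact h2 ⟨h1.1, lt_of_le_of_lt (not_lt.mp hle) hT'τ⟩
    have hsplit : ∫ t in Ioo 0 T, I t = ∫ t in Ioo 0 τ, I t := by
      have hunion : Ioo 0 T = Ioo 0 τ ∪ (Ioo 0 T \ Ioo 0 τ) :=
        (union_sdiff_cancel (Ioo_subset_Ioo_right hτT.le)).symm
      rw [hunion, setIntegral_union disjoint_sdiff_right (measurableSet_Ioo.diff measurableSet_Ioo) hintτ hzero,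
        hdiff, add_zero]
    change (∫ t in Ioo 0 T, I t) + ∫ x, β (θ₀ x) * ψ 0 x = 0
    rw [hsplit]
    exact key

/-- Iterated a.e. bound ⇒ `L^∞` on the slab (lifted currency); private copy of the bookkeeping lemma of
`RenormalisationNoAnomalyFullWindow`. [folklore] -/
private theorem isBoundedOnSlab_of_ae_ae_abs_le' {T M : ℝ} {θ : ℝ → UnitAddTorus d → ℝ}
    (hm : AEStronglyMeasurable (FunctionSpaces.Torus.stLift θ) (volume.restrict (Ioo 0 T ×ˢ univ)))
    (hb : ∀ᵐ t ∂(volume.restrict (Ioo 0 T)), ∀ᵐ x ∂(volume : Measure (UnitAddTorus d)), |θ t x| ≤ M) :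
    IsBoundedOnSlab T θ := by
  set μT : Measure ℝ := (volume : Measure ℝ).restrict (Ioo 0 T) with hμT
  set P : Measure (ℝ × UnitAddTorus d) := μT.prod volume with hP
  have hmu : AEStronglyMeasurable (uncurry θ) P := by
    rw [hP, hμT, ← volume_restrict_prod_eq]
    exact FunctionSpaces.Torus.aestronglyMeasurable_uncurry_of_stLift_restrict hm
  set θ' : ℝ × UnitAddTorus d → ℝ := hmu.mk (uncurry θ) with hθ'
  have hθ'm : Measurable θ' := hmu.stronglyMeasurable_mk.measurable
  have hθθ' : uncurry θ =ᵐ[P] θ' := hmu.ae_eq_mk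
  have hS : MeasurableSet {p : ℝ × UnitAddTorus d | |θ' p| ≤ M} :=
    measurableSet_le (continuous_abs.measurable.comp hθ'm) measurable_const
  have h1 : ∀ᵐ t ∂μT, ∀ᵐ x ∂(volume : Measure (UnitAddTorus d)), |θ' (t, x)| ≤ M := by
    filter_upwards [hb, Measure.ae_ae_of_ae_prod hθθ'] with t ht ht'
    filter_upwards [ht, ht'] with x hx hx'
    simp only [uncurry] at hx'
    rw [← hx']; exact hx
  have h2 : ∀ᵐ p ∂P, |θ' p| ≤ M := by
    rw [hP, Measure.ae_prod_iff_ae_ae hS]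
    exact h1
  have h3 : ∀ᵐ p ∂P, |uncurry θ p| ≤ M := by
    filter_upwards [h2, hθθ'] with p hp hp'
    rw [hp']; exact hp
  have hq := MeasureTheory.QuasiMeasurePreserving.prodMap
    (Measure.QuasiMeasurePreserving.id μT) (FunctionSpaces.Torus.quasiMeasurePreserving_proj (d := d))
  have h4 : ∀ᵐ q ∂(μT.prod (volume : Measure (EuclideanSpace ℝ d))),
      |FunctionSpaces.Torus.stLift θ q| ≤ M := by
    filter_upwards [hq.ae h3] with q hq'
    simpa [FunctionSpaces.Torus.stLift, uncurry] using hq'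
  have hprod : (volume.restrict (Ioo 0 T ×ˢ (univ : Set (EuclideanSpace ℝ d)))) = μT.prod volume := by
    rw [hμT, Measure.volume_eq_prod, ← Measure.prod_restrict, Measure.restrict_univ]
  unfold IsBoundedOnSlab
  rw [hprod] at hm ⊢
  exact memLp_top_of_bound hm M (h4.mono fun q hq' => by rw [Real.norm_eq_abs]; exact hq')

/-! ## §2 The refutation, modulo the DiPerna–Lions theorem for smooth drifts -/

/-- **`BagnaraEtAl2026_thm31` is false, modulo DiPerna–Lions for smooth drifts.**  HYPOTHESIS `H` (inline;
the classical DiPerna–Lions renormalisation theorem for planar drifts jointly smooth and divergence free on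
a closed slab `[0,τ] × T²` [cite: DiPernaLions1989, §II.3 Thm. II.3 and Cor. II.1 (drifts in
`L¹(0,T; W^{1,1})`, a fortiori smooth)]; NOT a vendored fact — its proof over the tree's mollified-equation
pipeline is the remaining work, after which this theorem specialises to `¬ BagnaraEtAl2026_thm31`).
CONCLUSION: the vendored fact `Literature.Analysis.FluidPDE.BagnaraEtAl2026_thm31` (BBDM Thm. 3.1 typed
over the half-open weak class with a full-window conclusion) is FALSE: the Drivas–Elgindi–Iyer–Jeong field
(`Torus.DEIJ.deij_theorem2`) renormalises on `[0,1)` yet dissipates `≥ c‖θ₀‖² > 0` on `(0,1)` at every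
`κ > 0`. [cite: DrivasEtAl2022, Thm. 2 (arXiv:1911.03271 p. 3)] [cite: BagnaraEtAl2026, Thm. 3.1 p. 11, Def. 2.1 p. 5] -/
theorem not_BagnaraEtAl2026_thm31_of_smoothDriftsRenormalise
    (H : ∀ (τ : ℝ) (v : ℝ → UnitAddTorus (Fin 2) → EuclideanSpace ℝ (Fin 2)), 0 < τ →
      FunctionSpaces.Torus.IsSmoothSpaceTimeOn (Icc 0 τ) v →
      (∀ t ∈ Icc 0 τ, FunctionSpaces.Torus.IsDivFree (v t)) → HasRenormalisationProperty τ v) :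
    ¬ Literature.Analysis.FluidPDE.BagnaraEtAl2026_thm31 := by
  classical
  intro h31
  -- the datum: `θ₀ = cos(2π x₁)`, smooth, bounded, mean zero, in `H²`, with `‖θ₀‖² = 1/2`
  set k₁ : Fin 2 → ℤ := Pi.single 0 1 with hk₁
  have hk₁0 : k₁ ≠ 0 := by
    intro h0; have := congrFun h0 0; simp [hk₁] at this
  set θ₀ : UnitAddTorus (Fin 2) → ℝ :=
    FunctionSpaces.Torus.reTrigPoly {k₁, -k₁} (fun _ => (((1 / 2 : ℝ)) : ℂ)) with hθ₀def
  have hθ₀s : FunctionSpaces.Torus.IsSmooth θ₀ := ArmstrongVicol2025.isSmooth_cosMode k₁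
  have hθ₀H2 : FunctionSpaces.Torus.MemSobolev 2 (fun x => (θ₀ x : ℂ)) := ArmstrongVicol2025.memSobolev_cosMode k₁ 2
  have hθ₀mean : FunctionSpaces.Torus.HasZeroMean θ₀ := ArmstrongVicol2025.hasZeroMean_cosMode hk₁0
  have hθ₀L2 : Torus.scalarL2Sq θ₀ = 1 / 2 := ArmstrongVicol2025.scalarL2Sq_cosMode hk₁0
  have hθ₀cont : Continuous θ₀ := hθ₀s.continuous
  obtain ⟨H0, hH0⟩ := (isCompact_univ.image hθ₀cont).isBounded.exists_norm_le
  have hθ₀bd : ∀ x, |θ₀ x| ≤ H0 := fun x => by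
    simpa [Real.norm_eq_abs] using hH0 _ ⟨x, mem_univ _, rfl⟩
  have hθ₀top : MemLp θ₀ ∞ volume :=
    memLp_top_of_bound hθ₀cont.aestronglyMeasurable H0 (Eventually.of_forall fun x => by
      rw [Real.norm_eq_abs]; exact hθ₀bd x)
  -- the DEIJ field on `[0,1)`
  have hd : 2 ≤ Fintype.card (Fin 2) := by simp
  obtain ⟨u, hs, hdiv, -, -, ⟨Cu, hCu⟩, c, hc, hall⟩ :=
    Torus.DEIJ.deij_theorem2 hd 0 zero_lt_one 1 one_pos θ₀ hθ₀H2 hθ₀mean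
  -- `u` is bounded and measurable on every slab `(0,τ) × T²`, `τ ≤ 1`
  have hu_top : ∀ τ, τ ≤ 1 → MemLp (FunctionSpaces.Torus.stLift u) ∞ (volume.restrict (Ioo 0 τ ×ˢ univ)) := by
    intro τ hτ
    have hm := hs.aestronglyMeasurable_stLift measurableSet_Ioo (Ioo_subset_Ico_self.trans (Ico_subset_Ico_right hτ))
    refine memLp_top_of_bound hm Cu ?_
    filter_upwards [ae_restrict_mem (measurableSet_Ioo.prod MeasurableSet.univ)] with p hp
    exact hCu p.1 ⟨hp.1.1.le, hp.1.2.trans_le hτ⟩ _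
  have hbdslab : IsBoundedOnSlab 1 u := hu_top 1 le_rfl
  have hdivae : ∀ᵐ t ∂(volume.restrict (Ioo 0 (1:ℝ))), FunctionSpaces.Torus.IsWeaklyDivFree (u t) := by
    filter_upwards [ae_restrict_mem measurableSet_Ioo] with t ht
    exact FunctionSpaces.Torus.IsDivFree.isWeaklyDivFree_holds (hs.isSmooth_slice (Ioo_subset_Ico_self ht))
      (hdiv t (Ioo_subset_Ico_self ht))
  -- renormalisation on `[0,1)`: DiPerna–Lions on each `[0,τ]`, `τ < 1`, then patching
  have hren : HasRenormalizationPropertyOn 1 u := by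
    refine hasRenormalisationProperty_iff_hasRenormalizationPropertyOn.1
      (hasRenormalisationProperty_of_forall_lt one_pos (hu_top 1 le_rfl) fun τ hτ hτ1 => ?_)
    exact H τ u hτ (hs.mono (Icc_subset_Ico_right hτ1)) fun t ht => hdiv t (Icc_subset_Ico_right hτ1 ht)
  -- bounded weak solutions of the `ε`-problems, `ε > 0`
  have hum1 : AEStronglyMeasurable (FunctionSpaces.Torus.stLift u) (volume.restrict (Ioo 0 (1:ℝ) ×ˢ univ)) :=
    hbdslab.1
  have hu2 := lintegral_lintegral_sq_lt_top_of_memLp_top_stLift hbdslab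
  have hex : ∀ ε : ℝ, 0 < ε → ∃ Θ : ℝ → UnitAddTorus (Fin 2) → ℝ, IsWeakScalarTransportOn 1 ε u θ₀ Θ ∧
      ∀ᵐ t ∂(volume.restrict (Ioo 0 (1:ℝ))), ∀ᵐ x ∂(volume : Measure (UnitAddTorus (Fin 2))), |Θ t x| ≤ H0 := by
    intro ε hε
    obtain ⟨Θ, hΘ, -, hΘb, -⟩ := exists_isWeakScalarTransportOn_of_abs_le hε one_pos
      hθ₀cont.aestronglyMeasurable (Eventually.of_forall hθ₀bd) hum1 hu2 hdivae
    exact ⟨Θ, hΘ, hΘb⟩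
  set θ : ℝ → ℝ → UnitAddTorus (Fin 2) → ℝ := fun ε => if hε : 0 < ε then (hex ε hε).choose else fun _ _ => 0
    with hθdef
  have hθsol : ∀ ε, 0 < ε → IsWeakScalarTransportOn 1 ε u θ₀ (θ ε) := fun ε hε => by
    simp only [hθdef, dif_pos hε]; exact (hex ε hε).choose_spec.1
  have hθbd : ∀ ε, 0 < ε → IsBoundedOnSlab 1 (θ ε) := fun ε hε => by
    have hb := (hex ε hε).choose_spec.2
    have hm := (hex ε hε).choose_spec.1.aestronglyMeasurable
    simp only [hθdef, dif_pos hε]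
    exact isBoundedOnSlab_of_ae_ae_abs_le' hm hb
  -- the false fact: dissipation on `(0,1)` → 0
  have hlim := (h31 (Fin 2) 1 one_pos u hbdslab hdivae hren θ₀ hθ₀top θ fun ε hε => ⟨hθbd ε hε, hθsol ε hε⟩).1
  -- the DEIJ floor at every `ε > 0`
  have hfloor : ∀ ε, 0 < ε → ENNReal.ofReal (c * Torus.scalarL2Sq θ₀) ≤ eScalarDissipation ε (θ ε) 0 1 :=
    fun ε hε => hall ε hε (θ ε) (hθsol ε hε)
  set F : ℝ≥0∞ := ENNReal.ofReal (c * Torus.scalarL2Sq θ₀) with hF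
  have hF0 : F ≠ 0 := by
    rw [hF, hθ₀L2]; exact (ENNReal.ofReal_pos.2 (by positivity)).ne'
  have hFtop : F ≠ ⊤ := ENNReal.ofReal_ne_top
  have hev : ∀ᶠ ε in 𝓝[>] (0:ℝ), eScalarDissipation ε (θ ε) 0 1 ≤ F / 2 :=
    ENNReal.tendsto_nhds_zero.1 hlim (F / 2) (ENNReal.half_pos hF0)
  obtain ⟨ε, hεD, hεpos⟩ := (hev.and self_mem_nhdsWithin).exists
  have hlt : F / 2 < F := ENNReal.half_lt_self hF0 hFtop
  exact absurd ((hfloor ε hεpos).trans hεD) (not_le.2 hlt)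

/-! ## §3 Membership in the technique class (DiPerna–Lions) and the unconditional refutation -/

/-- **Lipschitz drifts renormalise** (DiPerna–Lions 1989, §II.3, Thm. II.3 and Cor. II.1, drifts in
`L¹(0,T; W^{1,∞})`): a drift whose slices `u(t)` are `L(t)`-Lipschitz for a.e. `t ∈ (0,T)` with
`∫₀ᵀ L < ∞` has the renormalisation property on `[0,T)` — every bounded weak solution of the transport
equation with bounded datum renormalises under every `β ∈ C¹` (indeed every continuous `β`:
`Torus.IsWeakScalarTransportOn.comp_of_lipschitz_of_abs_le`). [cite: DiPernaLions1989, §II.3 Thm. II.3, Cor. II.1] -/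
theorem hasRenormalisationProperty_of_lipschitz {T : ℝ} {u : ℝ → UnitAddTorus d → EuclideanSpace ℝ d}
    {L : ℝ → ℝ≥0} (hlip : ∀ᵐ t ∂(volume.restrict (Ioo 0 T)), LipschitzWith (L t) (u t))
    (hL : ∫⁻ t in Ioo 0 T, (L t : ℝ≥0∞) < ⊤) : HasRenormalisationProperty T u := by
  intro θ₀ θ hθ₀ hbd hsol β hβ
  obtain ⟨M, hM⟩ := hbd
  exact hsol.comp_of_lipschitz_of_abs_le hθ₀ hM hβ.continuous hlip hL

/-- **Smooth drifts on a closed slab renormalise** (DiPerna–Lions 1989, §II.3, Thm. II.3 / Cor. II.1,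
a fortiori for `C^∞([0,τ] × T^d)` drifts): a field jointly smooth on `[0,τ] × T^d`, `τ > 0`, has the
renormalisation property on `[0,τ)` — its slices are `K`-Lipschitz uniformly in time (bounded spatial
partial derivatives on the compact slab, `Torus.lipschitzWith_of_norm_partialDeriv_le`).  Weak
incompressibility is part of the weak-solution class and is not needed as a hypothesis here.
[cite: DiPernaLions1989, §II.3 Thm. II.3, Cor. II.1] -/
theorem hasRenormalisationProperty_of_isSmoothSpaceTimeOn [DecidableEq d] {τ : ℝ} (hτ : 0 < τ)
    {v : ℝ → UnitAddTorus d → EuclideanSpace ℝ d}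
    (hv : FunctionSpaces.Torus.IsSmoothSpaceTimeOn (Icc 0 τ) v) : HasRenormalisationProperty τ v := by
  have hS : UniqueDiffOn ℝ (Icc 0 τ) := uniqueDiffOn_Icc hτ
  have hM : ∀ i : d, ∃ C : ℝ, ∀ t ∈ Icc 0 τ, ∀ x, ‖FunctionSpaces.Torus.partialDeriv i (v t) x‖ ≤ C :=
    fun i => (hv.partialDeriv hS i).exists_norm_le_of_isCompact isCompact_Icc subset_rfl
  choose M hM using hM
  set K : ℝ≥0 := NNReal.sqrt (Fintype.card d) * ∑ i, Real.toNNReal (M i) with hK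
  have hspace : ∀ t ∈ Icc 0 τ, LipschitzWith K (v t) := fun t ht =>
    FunctionSpaces.Torus.lipschitzWith_of_norm_partialDeriv_le ((hv.isSmooth_slice ht).isContDiff (by simp))
      (M := fun i => Real.toNNReal (M i)) fun i x => (hM i t ht x).trans (Real.le_coe_toNNReal _)
  have hlip : ∀ᵐ t ∂(volume.restrict (Ioo 0 τ)), LipschitzWith ((fun _ : ℝ => K) t) (v t) := by
    filter_upwards [ae_restrict_mem measurableSet_Ioo] with t ht
    exact hspace t (Ioo_subset_Icc_self ht)
  have hL : ∫⁻ t in Ioo 0 τ, (((fun _ : ℝ => K) t : ℝ≥0) : ℝ≥0∞) < ⊤ := by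
    show ∫⁻ _ in Ioo 0 τ, (K : ℝ≥0∞) < ⊤
    rw [setLIntegral_const]
    exact ENNReal.mul_lt_top ENNReal.coe_lt_top measure_Ioo_lt_top
  exact hasRenormalisationProperty_of_lipschitz hlip hL

/-- The same in the vocabulary of `RenormalizationNoDissipationAnomaly` (BBDM Def. 2.1 as typed there,
`Torus.HasRenormalizationPropertyOn`): smooth drifts on a closed slab renormalise on the half-open window.
[cite: DiPernaLions1989, §II.3 Thm. II.3, Cor. II.1] [cite: BagnaraEtAl2026, Def. 2.1 p. 5] -/
theorem _root_.Literature.Analysis.FluidPDE.Torus.hasRenormalizationPropertyOn_of_isSmoothSpaceTimeOn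
    [DecidableEq d] {τ : ℝ} (hτ : 0 < τ) {v : ℝ → UnitAddTorus d → EuclideanSpace ℝ d}
    (hv : FunctionSpaces.Torus.IsSmoothSpaceTimeOn (Icc 0 τ) v) : HasRenormalizationPropertyOn τ v :=
  hasRenormalisationProperty_iff_hasRenormalizationPropertyOn.1 (hasRenormalisationProperty_of_isSmoothSpaceTimeOn hτ hv)

/-- A field jointly smooth on the closed slab `[0,T] × T^d` is bounded on the open slab
(`Torus.IsBoundedOnSlab`). [folklore] -/
private theorem isBoundedOnSlab_of_isSmoothSpaceTimeOn {T : ℝ} {v : ℝ → UnitAddTorus d → EuclideanSpace ℝ d}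
    (hv : FunctionSpaces.Torus.IsSmoothSpaceTimeOn (Icc 0 T) v) : IsBoundedOnSlab T v := by
  obtain ⟨C, hC⟩ := hv.exists_norm_le_of_isCompact isCompact_Icc subset_rfl
  have hm : AEStronglyMeasurable (FunctionSpaces.Torus.stLift v) (volume.restrict (Ioo 0 T ×ˢ univ)) :=
    (hv.continuousOn_stLift.mono (prod_mono Ioo_subset_Icc_self subset_rfl)).aestronglyMeasurable
      (measurableSet_Ioo.prod MeasurableSet.univ)
  refine memLp_top_of_bound hm C ?_
  filter_upwards [ae_restrict_mem (measurableSet_Ioo.prod MeasurableSet.univ)] with p hp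
  exact hC p.1 (Ioo_subset_Icc_self hp.1) _

/-- **No dissipation anomaly strictly inside the smoothness slab** (Bagnara–Boutros–De Lellis–Mayboroda
2026, Thm. 3.1, in its corrected full-window form `BagnaraBoutrosDeLellisMayboroda2026_thm31_fullWindow`,
combined with DiPerna–Lions 1989, Thm. II.3): a field jointly smooth and divergence free on
`[0,T'] × T^d` allows NO dissipation anomaly (BBDM Def. 1.1, `Torus.AllowsDissipationAnomalyOn`) on any
window `[0,T]` with `0 < T < T'`.  (The Drivas–Elgindi–Iyer–Jeong field escapes exactly by losing
smoothness at the endpoint `T' = T = 1`.) [cite: BagnaraEtAl2026, Thm. 3.1 p. 11, Def. 1.1 p. 2]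
[cite: DiPernaLions1989, §II.3 Thm. II.3, Cor. II.1] -/
theorem _root_.Literature.Analysis.FluidPDE.Torus.not_allowsDissipationAnomalyOn_of_isSmoothSpaceTimeOn
    [DecidableEq d] {T T' : ℝ} (hT : 0 < T) (hTT' : T < T') {v : ℝ → UnitAddTorus d → EuclideanSpace ℝ d}
    (hv : FunctionSpaces.Torus.IsSmoothSpaceTimeOn (Icc 0 T') v)
    (hdiv : ∀ t ∈ Icc 0 T', FunctionSpaces.Torus.IsDivFree (v t)) : ¬ AllowsDissipationAnomalyOn T v := by
  have hdivw : ∀ᵐ t ∂(volume.restrict (Ioo 0 T')), FunctionSpaces.Torus.IsWeaklyDivFree (v t) := by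
    filter_upwards [ae_restrict_mem measurableSet_Ioo] with t ht
    exact (hdiv t (Ioo_subset_Icc_self ht)).isWeaklyDivFree_holds (hv.isSmooth_slice (Ioo_subset_Icc_self ht))
  exact not_allowsDissipationAnomalyOn_of_hasRenormalizationPropertyOn_beyond hT hTT'
    (isBoundedOnSlab_of_isSmoothSpaceTimeOn hv) hdivw
    (hasRenormalizationPropertyOn_of_isSmoothSpaceTimeOn (hT.trans hTT') hv)

/-- **The vendored fact `BagnaraEtAl2026_thm31` is FALSE** — unconditional kernel refutation (finding
L30-1): the Drivas–Elgindi–Iyer–Jeong field (`Torus.DEIJ.deij_theorem2`; ARMA 243 (2022), Thm. 2) is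
smooth and divergence free on every closed slab `[0,τ] × T²`, `τ < 1`, hence renormalises there
(DiPerna–Lions, `hasRenormalisationProperty_of_isSmoothSpaceTimeOn`) and, by patching, on `[0,1)`; yet
every weak solution of the `κ`-problem from `θ₀ = cos(2π x₁)` dissipates `≥ c‖θ₀‖² > 0` on `(0,1)` at
every `κ > 0`, so the full-window conclusion of the fact fails.  The PRINTED Theorem 3.1 of
Bagnara–Boutros–De Lellis–Mayboroda (global-in-time weak solutions, Def. 2.1 p. 5) is not affected; its
correct tree form is `BagnaraBoutrosDeLellisMayboroda2026_thm31_fullWindow`.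
[cite: DrivasEtAl2022, Thm. 2 (arXiv:1911.03271 p. 3)] [cite: BagnaraEtAl2026, Thm. 3.1 p. 11, Def. 2.1 p. 5]
[cite: DiPernaLions1989, §II.3 Thm. II.3, Cor. II.1] -/
theorem not_BagnaraEtAl2026_thm31 : ¬ Literature.Analysis.FluidPDE.BagnaraEtAl2026_thm31 :=
  not_BagnaraEtAl2026_thm31_of_smoothDriftsRenormalise fun _ _ hτ hv _ =>
    hasRenormalisationProperty_of_isSmoothSpaceTimeOn hτ hv

end Literature.Barriers.AnomalousDissipation

end
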